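import Summits.BirchSwinnertonDyer.BirchSwinnertonDyer.Theorems.PrintX11aUpperNonSurjFiveExcToolkitRoots
import Literature.NumberTheory.EllipticCurves.CanonicalPeriodSymbolCongruence
import HarnessLib

/-!
# Crux U5 `PrintX11a.UpperNonSurjFive` (item stmt-BirchSwinnertonDyer-20614), line «gl1cartan5», EXCEPTIONAL-ZERO road:
# the CORE — «`[0]⁺_f ≡ 0 (mod p)`» from a canonical-period symbol congruence with a stabilised form whose stabilisation
# constant is `c ≡ 1`, and its Greenberg–Vatsal 2000 wrapper (general prime `p`, `p ∥ N`)

Cell `bsd-print-x11a`, seat `cruxlead-stmt-BirchSwinnertonDyer-20614` (LEAD g6); `--supports stmt-BirchSwinnertonDyer-20614`,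
closes nothing. File 2 of the EXCEPTIONAL-ZERO road. The bsd-addord acc2 THEOREM A
(`KimAtThreeDeepLowerOffStratumLevelLoweringVatsal.isStabilisedLevelLoweringCongruenceIn_of_symbolCongruence`, `p = 3`) turns
Vatsal's conclusion shape for a pair `(f, g')` + the OLD SHAPE `plusSymbol g' = Φ − c·Φ(q·)` + a non-degenerate normalisation `Ω`
of `Φ` into the full congruence (LL₁) `[x]⁺_f ≡ u·(φ(x) − φ(qx))`. The exceptional-zero road needs only its value AT `x = 0`, where
`φ(0) − φ(q·0) = 0`: THIS FILE proves, at a general prime `p` and for any `q`, that under the same displayed data the rational plus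
symbol `[0]⁺_f = L(f,1)/Ω⁺_f` of the newform `f` of `W` has `p`-ADIC VALUATION `≥ 1` (§1), and wraps it with the tree's named fact
`greenbergVatsal2000_plusSymbol_congruence` (Greenberg–Vatsal 2000 §3 (17)–(19) / Vatsal 1999 Thm. (1.13) second bullet: `f` the
newform of `W` at level `N = M`, `p ∥ N` multiplicative, `E[p]` irreducible) taken BY NAME as a hypothesis (§2), in the two forms the
assembly uses (non-degeneracy displayed, resp. PRODUCED from `plusSymbol g' ≢ 0`, which the congruence supplies). Theorems only; no
definition, no named fact, no `sorry`; nothing about any curve is asserted; BSD is not proved by any of this.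

* §0 `one_le_padicValRat_of_norm_lt_one` — a nonzero rational of `p`-adic norm `< 1` has valuation `≥ 1`.
* §1 ★ `one_le_padicValRat_ratPlusSymbol_zero_of_symbolCongruence` — THE CORE.
* §2 `one_le_padicValRat_ratPlusSymbol_zero_of_greenbergVatsal`, `…_of_greenbergVatsal_of_exists_period`.

## References

* V. Vatsal, *Canonical periods and congruence formulae*, Duke Math. J. 98 (1999), §1 (1.6) display (11), Remark (1.12), Thm. (1.13).
  [Vatsal1999]
* R. Greenberg, V. Vatsal, *On the Iwasawa invariants of elliptic curves*, Invent. Math. 142 (2000), §3 (17)–(19), Lemma (3.6),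
  proof of Thm. (3.10). [GreenbergVatsal2000]
* B. Mazur, J. Tate, J. Teitelbaum, Invent. Math. 84 (1986), §I.4 (4.2), §I.8. [MazurTateTeitelbaum1986Invent]
-/

set_option autoImplicit false
-- the Theorems namespace of a single-conjunct summit repeats the summit name by design (D-0017)
set_option linter.dupNamespace false

noncomputable section

open scoped MatrixGroups ModularForm Classical NNReal

open CongruenceSubgroup WeierstrassCurve Literature.NumberTheory.EllipticCurves
  Literature.NumberTheory.EllipticCurves.ModularForms

namespace Summit.BirchSwinnertonDyer.BirchSwinnertonDyer.Theorems.GL1Cartan.Exc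

open Summit.BirchSwinnertonDyer.BirchSwinnertonDyer.Theorems.KimAtThreeDeepLowerTamagawaLevelLowering
  (not_dvd_den_of_padicValRat_nonneg)
open Summit.BirchSwinnertonDyer.BirchSwinnertonDyer.Theorems.KimAtThreeDeepLowerOffStratumLevelLoweringVatsal
  (plusSymbol_eq_ratPlusSymbol_mul_plusPeriod)
open Summit.BirchSwinnertonDyer.BirchSwinnertonDyer.Theorems.KimAtThreeDeepLowerOffStratumLevelLoweringVatsalRows
  (finiteDimensional_coeffField_of_isNewformOf)

/-! ### §0 A rational of `p`-adic norm `< 1` -/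

section Rat

variable {p : ℕ} [Fact p.Prime]

/-- A nonzero rational number `r` with `‖r‖_p < 1` has `1 ≤ ord_p r` (`‖r‖_p = p^{−ord_p r}`). [folklore] -/
theorem one_le_padicValRat_of_norm_lt_one {r : ℚ} (hr : r ≠ 0) (h : ‖(r : ℚ_[p])‖ < 1) : 1 ≤ padicValRat p r := by
  have hp : p.Prime := Fact.out
  rw [Padic.norm_eq_zpow_neg_valuation (by exact_mod_cast hr), Padic.valuation_ratCast] at h
  have hp1 : (1 : ℝ) < p := by exact_mod_cast hp.one_lt
  have hneg : -padicValRat p r < 0 := by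
    by_contra hle
    push Not at hle
    have : (1 : ℝ) ≤ (p : ℝ) ^ (-padicValRat p r) := one_le_zpow₀ hp1.le hle
    exact absurd h (not_lt.mpr this)
  omega

/-- The `ι⁻¹`-image of (the complex cast of) a rational is its cast into `ℚ̄_p`, whose norm is the `p`-adic norm. [folklore] -/
theorem norm_symm_ratCast (ι : PadicAlgCl p ≃+* ℂ) (r : ℚ) : ‖ι.symm ((r : ℚ) : ℂ)‖ = ‖(r : ℚ_[p])‖ := by
  rw [map_ratCast, show (r : PadicAlgCl p) = ((r : ℚ_[p]) : PadicAlgCl p) by push_cast; rfl, PadicAlgCl.norm_extends]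

end Rat

/-! ### §1 THE CORE: `[0]⁺_f ≡ 0` from the symbol congruence, the old shape with `c ≡ 1`, and the non-degeneracy -/

section Core

variable {p : ℕ} [Fact p.Prime]

/-- ★ **The core of the exceptional-zero road.** Let `f` be the newform of `W` at level `N` with `p`-integral rational plus
symbols `[x]⁺_f` (`hint`), `g' ∈ S₂(Γ₀(N))` any form, and suppose (the CONCLUSION SHAPE of Vatsal 1999 §1 / Greenberg–Vatsal
2000 §3 for the pair `(f, g')`, read through `ι : ℚ̄_p ≃ ℂ`): there are `Ω_f, Ω_g ∈ ℂˣ` with `plusSymbol g' x/Ω_g` integral and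
`plusSymbol f x/Ω_f ≡ plusSymbol g' x/Ω_g (mod 𝔪)` for every `x`, and `plusSymbol f x₁/Ω_f` a unit for some `x₁`. Suppose the plus
symbol of `g'` has the OLD SHAPE `plusSymbol g' x = Φ(x) − c·Φ(qx)` with `c ≡ 1 (mod 𝔪)` (in print: `g'` the `q`-stabilisation of an
eigenform with plus symbol `Φ`, `c = β/q`), and the NON-DEGENERACY: for some `Ω ∈ ℂ`, `Φ/Ω` is integral on `ℚ` and
`(Φ(x₀) − cΦ(qx₀))/Ω` is a unit for some `x₀` (Ihara's lemma read on symbols). THEN `[0]⁺_f = 0` or `1 ≤ ord_p [0]⁺_f`.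
Indeed `Ω/Ω_g` is integral (evaluate at `x₀`), so `plusSymbol g' 0/Ω_g = (Ω/Ω_g)·(1 − c)·Φ(0)/Ω ∈ 𝔪`; `Ω_f/Ω⁺_f` is integral
(evaluate at `x₁`), so `[0]⁺_f = (Ω_f/Ω⁺_f)·plusSymbol f 0/Ω_f ∈ 𝔪`. Pure ultrametric algebra + `plusSymbol f = [·]⁺_f · Ω⁺_f`.
[cite: Vatsal1999, §1 (1.6) display (11), Remark (1.12)] [cite: GreenbergVatsal2000, §3 (18)–(19) and Lemma (3.6)]
[cite: MazurTateTeitelbaum1986Invent, §I.4 (4.2) and §I.8] -/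
theorem one_le_padicValRat_ratPlusSymbol_zero_of_symbolCongruence
    (W : WeierstrassCurve ℚ) [W.IsElliptic] [W.IsGloballyMinimal] {N : ℕ} [NeZero N]
    {f g' : CuspForm (Gamma0 N) 2} (hf : IsNewformOf W f) (ι : PadicAlgCl p ≃+* ℂ)
    (hint : ∀ r : ℚ, ratPlusSymbol f r ≠ 0 → 0 ≤ padicValRat p (ratPlusSymbol f r))
    {Ωf Ωg : ℂ} (hΩf : Ωf ≠ 0) (hΩg : Ωg ≠ 0)
    (hψint : ∀ x : ℚ, Valued.v (ι.symm (plusSymbol g' x / Ωg)) ≤ 1)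
    (hcongr : ∀ x : ℚ, Valued.v (ι.symm (plusSymbol f x / Ωf - plusSymbol g' x / Ωg)) < 1)
    (hΨunit : ∃ x₁ : ℚ, Valued.v (ι.symm (plusSymbol f x₁ / Ωf)) = 1)
    (q : ℕ) (Φ : ℚ → ℂ) (c : ℂ)
    (hshape : ∀ x : ℚ, plusSymbol g' x = Φ x - c * Φ (q * x))
    (hc : Valued.v (ι.symm (c - 1)) < 1)
    {Ω : ℂ} (hΩint : ∀ x : ℚ, Valued.v (ι.symm (Φ x / Ω)) ≤ 1)
    (hΩunit : ∃ x₀ : ℚ, Valued.v (ι.symm ((Φ x₀ - c * Φ (q * x₀)) / Ω)) = 1) :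
    ratPlusSymbol f 0 ≠ 0 → 1 ≤ padicValRat p (ratPlusSymbol f 0) := by
  intro h0
  -- Step 1 (`f`-side): `[x]⁺ = κ·Ψ(x)`, `Ψ(x) = plusSymbol f x/Ω_f`, `κ = Ω_f/Ω⁺`, `‖κ‖ ≤ 1`
  have hΩpos : 0 < plusPeriod f := IsNewform0.plusPeriod_pos_holds hf.1 hf.coeffField_eq_bot
  set κ : ℂ := Ωf / ((plusPeriod f : ℝ) : ℂ) with hκdef
  have hκ : ∀ x : ℚ, ((ratPlusSymbol f x : ℚ) : ℂ) = κ * (plusSymbol f x / Ωf) := by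
    intro x
    rw [plusSymbol_eq_ratPlusSymbol_mul_plusPeriod hf x, hκdef]
    have : ((plusPeriod f : ℝ) : ℂ) ≠ 0 := by exact_mod_cast hΩpos.ne'
    field_simp
  have hratint : ∀ x : ℚ, ‖ι.symm (((ratPlusSymbol f x : ℚ) : ℂ))‖ ≤ 1 := by
    intro x
    rw [map_ratCast]
    exact norm_ratCast_le_one (not_dvd_den_of_padicValRat_nonneg p f hint x)
  have hκint : ‖ι.symm κ‖ ≤ 1 := by
    obtain ⟨x₁, hx₁⟩ := hΨunit
    have h := congrArg ι.symm (hκ x₁)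
    rw [map_mul] at h
    have h' : ‖ι.symm (((ratPlusSymbol f x₁ : ℚ) : ℂ))‖ = ‖ι.symm κ‖ := by
      rw [h, norm_mul, valuation_eq_one_iff.mp hx₁, mul_one]
    rw [← h']
    exact hratint x₁
  -- Step 2 (`g`-side): `ψ(x) = λ · (Φ(x) − cΦ(qx))/Ω` with `λ = Ω/Ω_g`, `‖λ‖ ≤ 1`
  have hΩ0 : Ω ≠ 0 := by
    rintro rfl
    obtain ⟨x₀, hx₀⟩ := hΩunit
    exact zero_ne_one (by rwa [div_zero, map_zero, Valuation.map_zero] at hx₀)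
  set lam : ℂ := Ω / Ωg with hlamdef
  have hlam : ∀ x : ℚ, plusSymbol g' x / Ωg = lam * ((Φ x - c * Φ (q * x)) / Ω) := by
    intro x
    rw [hshape x, hlamdef]
    field_simp
  have hlamint : ‖ι.symm lam‖ ≤ 1 := by
    obtain ⟨x₀, hx₀⟩ := hΩunit
    have h := congrArg ι.symm (hlam x₀)
    rw [map_mul] at h
    have h' : ‖ι.symm (plusSymbol g' x₀ / Ωg)‖ = ‖ι.symm lam‖ := by
      rw [h, norm_mul, valuation_eq_one_iff.mp hx₀, mul_one]
    rw [← h']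
    exact valuation_le_one_iff.mp (hψint x₀)
  -- Step 3: `ψ(0) = λ (1 − c) Φ(0)/Ω` has norm `< 1`
  have hψ0 : ‖ι.symm (plusSymbol g' 0 / Ωg)‖ < 1 := by
    have h : plusSymbol g' 0 / Ωg = lam * ((1 - c) * (Φ 0 / Ω)) := by
      rw [hlam 0, mul_zero]
      ring
    rw [h, map_mul, map_mul, norm_mul, norm_mul]
    have h1c : ‖ι.symm (1 - c)‖ < 1 := by
      rw [← neg_sub, map_neg, norm_neg]
      exact valuation_lt_one_iff.mp hc
    calc ‖ι.symm lam‖ * (‖ι.symm (1 - c)‖ * ‖ι.symm (Φ 0 / Ω)‖)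
        ≤ 1 * (‖ι.symm (1 - c)‖ * 1) := by
          refine mul_le_mul hlamint ?_ (by positivity) zero_le_one
          exact mul_le_mul_of_nonneg_left (valuation_le_one_iff.mp (hΩint 0)) (norm_nonneg _)
      _ < 1 := by rw [one_mul, mul_one]; exact h1c
  -- Step 4: `Ψ_f(0) ≡ ψ(0)`, so `‖Ψ_f(0)‖ < 1`, so `‖[0]⁺_f‖ < 1`
  have hΨ0 : ‖ι.symm (plusSymbol f 0 / Ωf)‖ < 1 := by
    have h1 := valuation_lt_one_iff.mp (hcongr 0)
    rw [map_sub] at h1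
    have : ι.symm (plusSymbol f 0 / Ωf) =
        (ι.symm (plusSymbol f 0 / Ωf) - ι.symm (plusSymbol g' 0 / Ωg)) + ι.symm (plusSymbol g' 0 / Ωg) := by ring
    rw [this]
    exact lt_of_le_of_lt (PadicAlgCl.isNonarchimedean p _ _) (max_lt h1 hψ0)
  have hrat : ‖((ratPlusSymbol f 0 : ℚ) : ℚ_[p])‖ < 1 := by
    rw [← norm_symm_ratCast ι, hκ 0, map_mul, norm_mul]
    calc ‖ι.symm κ‖ * ‖ι.symm (plusSymbol f 0 / Ωf)‖ ≤ 1 * ‖ι.symm (plusSymbol f 0 / Ωf)‖ :=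
          mul_le_mul_of_nonneg_right hκint (norm_nonneg _)
      _ < 1 := by rw [one_mul]; exact hΨ0
  exact one_le_padicValRat_of_norm_lt_one h0 hrat

end Core

/-! ### §2 The Greenberg–Vatsal wrapper at a multiplicative `p ∥ N` (named fact BY NAME, as a hypothesis) -/

section GV

variable {p : ℕ} [Fact p.Prime]

/-- **`[0]⁺_f ≡ 0` at a MULTIPLICATIVE `p ∥ N` from Greenberg–Vatsal 2000 BY NAME.** Data: the named fact
`greenbergVatsal2000_plusSymbol_congruence` (hypothesis `hGV`); `W` with multiplicative reduction at the odd prime `p`, `E[p]`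
irreducible, `p² ∤ N`, `5 ≤ N`; its newform `f` at level `N` with `p`-integral `[x]⁺_f`; a normalised Hecke eigenform
`g' ∈ S₂(Γ₀(N))` with number-field `p`-integral coefficients, Vatsal's Condition 1, `aₙ(f) ≡ aₙ(g')` for ALL `n`; the old shape
`(Φ, c)` of `plusSymbol g'` with `c ≡ 1`; the non-degeneracy `Ω`. The fact is applied to `f₀ = f` in its own Hecke family at `M = N`
(`U_p`-eigenvalue `a_p(E) = ±1`, a unit) and `g'`, exactly as in the acc2 file `…VatsalRows` at `p = 3`; Condition 1 for the newform `f`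
is the tree theorem `hasSimpleHeckeGenEigenspace_of_isNewform0`. [cite: GreenbergVatsal2000, §3 (17)–(19), proof of Thm. (3.10)]
[cite: Vatsal1999, §1 (1.6), Remark (1.12), Thm. (1.13)] -/
theorem one_le_padicValRat_ratPlusSymbol_zero_of_greenbergVatsal (hGV : greenbergVatsal2000_plusSymbol_congruence)
    (W : WeierstrassCurve ℚ) [W.IsElliptic] [W.IsGloballyMinimal] {N : ℕ} [NeZero N]
    {f g' : CuspForm (Gamma0 N) 2} (hf : IsNewformOf W f) (ι : PadicAlgCl p ≃+* ℂ) (hp2 : p ≠ 2)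
    (hpN : ¬ p ^ 2 ∣ N) (h5 : 5 ≤ N) (hmult : W.HasMultiplicativeReductionAtPrime p)
    (hirr : W.HasIrreducibleModPGaloisRep p)
    (hint : ∀ r : ℚ, ratPlusSymbol f r ≠ 0 → 0 ≤ padicValRat p (ratPlusSymbol f r))
    (hg : IsHeckeEigenform g') (hg1 : IsNormalized g') (hgK : FiniteDimensional ℚ (coeffField g'))
    (hgint : ∀ n : ℕ, Valued.v (ι.symm (cuspCoeff g' n)) ≤ 1) (hgC : HasSimpleHeckeGenEigenspace g')
    (hcong : ∀ n : ℕ, Valued.v (ι.symm (cuspCoeff f n - cuspCoeff g' n)) < 1)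
    (q : ℕ) (Φ : ℚ → ℂ) (c : ℂ)
    (hshape : ∀ x : ℚ, plusSymbol g' x = Φ x - c * Φ (q * x))
    (hc : Valued.v (ι.symm (c - 1)) < 1)
    {Ω : ℂ} (hΩint : ∀ x : ℚ, Valued.v (ι.symm (Φ x / Ω)) ≤ 1)
    (hΩunit : ∃ x₀ : ℚ, Valued.v (ι.symm ((Φ x₀ - c * Φ (q * x₀)) / Ω)) = 1) :
    ratPlusSymbol f 0 ≠ 0 → 1 ≤ padicValRat p (ratPlusSymbol f 0) := by
  have hfC : HasSimpleHeckeGenEigenspace f :=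
    KimAtThreeDeepLowerOffStratumLevelLoweringConditionOne.hasSimpleHeckeGenEigenspace_of_isNewform0 hf.1
  obtain ⟨Ωf, Ωg, hΩf, hΩg, -, hψint, hcongr, x₁, hx₁⟩ :=
    hGV p N N ι W f f g' hp2 h5 dvd_rfl hpN (Or.inr hmult) hirr hf hf.1.2.1 hf.1.2.2
      (finiteDimensional_coeffField_of_isNewformOf W hf) (valuation_cuspCoeff_le_one_of_isNewformOf hf ι) hfC
      (fun n _ => hf.2 n) (fun _ => valuation_cuspCoeff_eq_one_of_mult ι W hf hmult) hg hg1 hgK hgint hgC hcong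
  exact one_le_padicValRat_ratPlusSymbol_zero_of_symbolCongruence W hf ι hint hΩf hΩg hψint hcongr ⟨x₁, hx₁⟩ q Φ c
    hshape hc hΩint hΩunit

/-- From the conclusion shape: the `g'`-side normalised symbol is a unit at the `f`-side unit point `x₁`, so
`plusSymbol g' x₁ ≠ 0`. [cite: Vatsal1999, Remark (1.12)] -/
theorem plusSymbol_ne_zero_of_congr (ι : PadicAlgCl p ≃+* ℂ) {N : ℕ} {f g' : CuspForm (Gamma0 N) 2} {Ωf Ωg : ℂ}
    (hcongr : ∀ x : ℚ, Valued.v (ι.symm (plusSymbol f x / Ωf - plusSymbol g' x / Ωg)) < 1)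
    {x₁ : ℚ} (hx₁ : Valued.v (ι.symm (plusSymbol f x₁ / Ωf)) = 1) : plusSymbol g' x₁ ≠ 0 := by
  intro h0
  have h := hcongr x₁
  rw [h0, zero_div, sub_zero, hx₁] at h
  exact lt_irrefl _ h

/-- **The same with the non-degeneracy `Ω` PRODUCED from `plusSymbol g' ≢ 0`** (which the congruence supplies: the
`g'`-symbol is a unit where the `f`-symbol is). This is the form the assembly uses: the period producer (`…ExcPeriod`) needs
`plusSymbol g' x ≠ 0` for one `x`. [cite: GreenbergVatsal2000, §3 (17)–(19)] [cite: Vatsal1999, §1 (1.6), Remark (1.12)] -/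
theorem one_le_padicValRat_ratPlusSymbol_zero_of_greenbergVatsal_of_exists_period
    (hGV : greenbergVatsal2000_plusSymbol_congruence)
    (W : WeierstrassCurve ℚ) [W.IsElliptic] [W.IsGloballyMinimal] {N : ℕ} [NeZero N]
    {f g' : CuspForm (Gamma0 N) 2} (hf : IsNewformOf W f) (ι : PadicAlgCl p ≃+* ℂ) (hp2 : p ≠ 2)
    (hpN : ¬ p ^ 2 ∣ N) (h5 : 5 ≤ N) (hmult : W.HasMultiplicativeReductionAtPrime p)
    (hirr : W.HasIrreducibleModPGaloisRep p)
    (hint : ∀ r : ℚ, ratPlusSymbol f r ≠ 0 → 0 ≤ padicValRat p (ratPlusSymbol f r))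
    (hg : IsHeckeEigenform g') (hg1 : IsNormalized g') (hgK : FiniteDimensional ℚ (coeffField g'))
    (hgint : ∀ n : ℕ, Valued.v (ι.symm (cuspCoeff g' n)) ≤ 1) (hgC : HasSimpleHeckeGenEigenspace g')
    (hcong : ∀ n : ℕ, Valued.v (ι.symm (cuspCoeff f n - cuspCoeff g' n)) < 1)
    (q : ℕ) (Φ : ℚ → ℂ) (c : ℂ)
    (hshape : ∀ x : ℚ, plusSymbol g' x = Φ x - c * Φ (q * x))
    (hc : Valued.v (ι.symm (c - 1)) < 1)
    (hΩ : (∃ x : ℚ, plusSymbol g' x ≠ 0) →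
      ∃ Ω : ℂ, (∀ x : ℚ, Valued.v (ι.symm (Φ x / Ω)) ≤ 1) ∧
        ∃ x₀ : ℚ, Valued.v (ι.symm ((Φ x₀ - c * Φ (q * x₀)) / Ω)) = 1) :
    ratPlusSymbol f 0 ≠ 0 → 1 ≤ padicValRat p (ratPlusSymbol f 0) := by
  have hfC : HasSimpleHeckeGenEigenspace f :=
    KimAtThreeDeepLowerOffStratumLevelLoweringConditionOne.hasSimpleHeckeGenEigenspace_of_isNewform0 hf.1
  obtain ⟨Ωf, Ωg, hΩf, hΩg, -, hψint, hcongr, x₁, hx₁⟩ :=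
    hGV p N N ι W f f g' hp2 h5 dvd_rfl hpN (Or.inr hmult) hirr hf hf.1.2.1 hf.1.2.2
      (finiteDimensional_coeffField_of_isNewformOf W hf) (valuation_cuspCoeff_le_one_of_isNewformOf hf ι) hfC
      (fun n _ => hf.2 n) (fun _ => valuation_cuspCoeff_eq_one_of_mult ι W hf hmult) hg hg1 hgK hgint hgC hcong
  obtain ⟨Ω, hΩint, hΩunit⟩ := hΩ ⟨x₁, plusSymbol_ne_zero_of_congr ι hcongr hx₁⟩
  exact one_le_padicValRat_ratPlusSymbol_zero_of_symbolCongruence W hf ι hint hΩf hΩg hψint hcongr ⟨x₁, hx₁⟩ q Φ c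
    hshape hc hΩint hΩunit

end GV

end Summit.BirchSwinnertonDyer.BirchSwinnertonDyer.Theorems.GL1Cartan.Exc

end
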